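import Literature.Analysis.DeBrangesSpaces.Basic
import Mathlib.Analysis.SpecialFunctions.Log.Basic
import HarnessLib

/-!
# The spaces `𝓕(W)` and de Branges' positivity theorem in the form of Conrey–Li 2000, Theorem 2

LABEL (line 1): RH-FREE corpus vocabulary + ONE conditional named fact over a GENERAL function `W`
(the positivity condition is a HYPOTHESIS, never instantiated). bears_on: B-C/B-P (LADDER-RH §1,
COLUMN 6 DBR). WHAT THIS IS NOT: not progress toward RH — for `W(z) = 1/ξ(1 − iz)` and for
`W_χ(z) = 1/ξ(1 − iz, χ)` the hypothesis of Theorem 2 FAILS (Conrey–Li 2000 §3.1 (3.4), §3.2, §4;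
tree: `Literature.Barriers.RiemannHypothesis.ConreyLi2000_FW_holds`,
`Literature/Barriers/RiemannHypothesis/DeBrangesPositivityDirichlet.lean`); formalising the theorem
fixes WHICH inequality would have given `ζ(s) ≠ 0` on `Re s > 1/2`, it does not move RH.

J. B. Conrey, X.-J. Li, *A note on some positivity conditions related to zeta and L-functions*,
IMRN 2000:18, 929–940 = arXiv:math/9812166, §2 (read: arXiv pp. 2–3, the paragraph after the
proof of Theorem 1 through the end of the proof of Theorem 2). Companion of
`Literature/Analysis/DeBrangesSpaces/DeBrangesPositivity.lean` (`conreyLi2000_thm1`, the `𝓗(E)`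
theorem, PROVED in `DeBrangesPositivityProofs.lean`), whose header lists Theorem 2 under "What is
NOT here".

## The printed text (arXiv p. 2, lines 34–71 of the held text `paper:arxiv-math_9812166` p0002)

> Let `W(z)` be a function analytic and having no zeros in the upper half-plane. Then a Hilbert
> space of analytic functions `𝓕(W)` is the set of all analytic functions `F(z)` in the upper
> half-plane, such that `F(z)/W(z)` can be written as a quotient of bounded analytic functions in
> the upper half-plane, has square integrable boundary values on the real axis, and satisfies the
> inequality `log|F(x+iy)/W(x+iy)| ≤ (y/π) ∫ log|F(t)/W(t)| dt / ((t−x)² + y²)` for `y > 0`. The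
> inner product of `𝓕(W)` is given by `⟨F(z), G(z)⟩_{𝓕(W)} = ∫ F(x) Ḡ(x)/|W(x)|² dx` for all
> `F, G ∈ 𝓕(W)`. The reproducing kernel function of `𝓕(W)` is given by the expression
> `K(w, z) = W(z) W̄(w) / (2πi(w̄ − z))`, that is, for every complex `w` in the upper half-plane,
> we have `F(w) = ⟨F(z), K(w, z)⟩_{𝓕(W)}` (2.6) for every element `F ∈ 𝓕(W)`.
>
> **Theorem 2.** Let `W(z)` be a function analytic and having no zeros in the upper half-plane.
> Let `T` be a linear transformation of `𝓕(W)` into itself which takes `K(w, z)` into `K(w+i, z)`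
> for all complex `w` with `Im w > 0`. Assume that `Re ⟨F(z), TF(z)⟩_{𝓕(W)} ≥ 0` for all
> `F ∈ 𝓕(W)`. Then `W(z)` has an analytic extension to the half-plane `Im z > −1/2`, and
> `W(z)/W(z+i)` has a nonnegative real part in this half-plane.

## Rendering

Elements of `𝓕(W)` are functions on the OPEN upper half-plane `{z | 0 < Im z}`; they are carried
as total functions `ℂ → ℂ` whose values off the open upper half-plane are never used (every
clause below reads `F`, `W` on `{0 < Im z}` only, and boundary values are LIMITS from inside).

* `IsBoundedTypeUHP g` — "`g` can be written as a quotient of bounded analytic functions in the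
  upper half-plane": `g = φ/ψ` on `{0 < Im z}` with `φ, ψ` analytic and bounded there and `ψ`
  zero-free (for analytic `g` this is the usual Nevanlinna class; the zero-free denominator avoids
  Lean's `x/0 = 0`).
* `bdryValue g x` — the boundary value `lim_{y → 0⁺} g(x + iy)` (vertical limit; `limUnder`, junk
  where the limit does not exist) and `HasBdryValues g` — the limit exists for a.e. real `x`
  ("has … boundary values on the real axis").
* `HasPoissonLogMajorant g` — the displayed inequality, with the Poisson integral of
  `log|g(t)|` taken over the boundary function, its integrability made explicit (for the printed
  class it holds automatically: `log⁺|g| ≤ |g| ∈ L²`, and `log⁻|g|` is Poisson-integrable for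
  `g ≢ 0` of bounded type), and the inequality imposed only where `g(x+iy) ≠ 0` (at a zero the
  printed left side is `−∞`; Lean's `Real.log 0 = 0` would otherwise add a spurious condition).
* `SpaceF.Mem W F` — membership `F ∈ 𝓕(W)`: `F` analytic on `{0 < Im z}`, and `g = F/W` has the
  three printed properties, square-integrability being `MemLp (bdryValue g) 2`.
* `SpaceF.inner W F G = ∫ b_{F/W}(x) conj(b_{G/W}(x)) dx` — the printed `∫ F Ḡ/|W|² dx` written
  with the boundary functions `b_{F/W} = bdryValue (F/W)` (`F Ḡ/|W|² = (F/W)·conj(G/W)`).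
* `SpaceF.kernel W w z = W(z) conj(W(w)) / (2πi (conj w − z))` — the printed `K(w, z)`.
* `SpaceF.IsKernelShift W T` — "`T` is a linear transformation of `𝓕(W)` into itself which takes
  `K(w, z)` into `K(w+i, z)` for all `Im w > 0`": maps members to members, additive and homogeneous
  on members, and `T K(w, ·) = K(w+i, ·)`, all as equalities ON THE OPEN UPPER HALF-PLANE.
* `conreyLi2000_thm2` — Theorem 2 verbatim over this vocabulary (named fact, NOT proved here: the
  printed proof, pp. 2–3, needs the reproducing identity (2.6), i.e. Cauchy's formula for
  Nevanlinna-class quotients with `L²` boundary values, and a contraction/adjoint argument in the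
  space with kernel `1/(2πi(w̄ − z − i))` — none of it in Mathlib). Consequences PROVED here:
  the necessary condition read on the open upper half-plane (`re_div_nonneg_of_im_pos`) and, for
  `W` continuous on the closed upper half-plane, on the real axis (`re_div_nonneg_of_im_nonneg`) —
  the form refuted at real points by Conrey–Li's (3.4) (`w = −282`) and its `χ₄`/all-`χ` analogues.

Safety of the rendering (why the typed fact is implied by the printed theorem and is not
vacuously stronger): the printed proof uses the hypotheses only through finite combinations
`F = Σ c_α K(w_α, ·)`, `Im w_α > 0`; these satisfy `SpaceF.Mem W` as typed (`F/W` is a rational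
function with poles in the lower half-plane: bounded type with `ψ = 1`, continuous boundary values
in `L²`, and the Poisson majorant holds for rational functions pole-free on the closed half-plane),
`T` acts on them by linearity exactly as in the proof, and `SpaceF.inner` is the printed integral.

## References

* [ConreyLi2000] J. B. Conrey, X.-J. Li, IMRN 2000:18, 929–940 = arXiv:math/9812166, §2: the
  space `𝓕(W)`, (2.6), Theorem 2 with proof (2.7)–(2.8) (read, arXiv pp. 2–3).
* [deBranges1986] L. de Branges, Bull. AMS 15 (1986) 1–17 ("essentially due to de Branges",
  Conrey–Li p. 1; cf. their refs. [2], [3] = de Branges 1986, 1992).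
-/

noncomputable section

open scoped ComplexConjugate Real
open _root_.Complex _root_.MeasureTheory _root_.Filter _root_.Topology

namespace Literature.Analysis.DeBrangesSpaces

/-! ## Analytic functions on the upper half-plane: bounded type, boundary values, Poisson majorant -/

/-- **Bounded type in the upper half-plane** (Conrey–Li: "`F(z)/W(z)` can be written as a quotient
of bounded analytic functions in the upper half-plane"): `g = φ/ψ` on `{0 < Im z}` with `φ`, `ψ`
analytic and bounded there and `ψ` without zeros there (so that `φ z / ψ z` is a genuine quotient;
for analytic `g` a denominator with zeros can always be replaced by a zero-free one).
[cite: ConreyLi2000, §2 (definition of 𝓕(W))] -/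
def IsBoundedTypeUHP (g : ℂ → ℂ) : Prop :=
  ∃ φ ψ : ℂ → ℂ, DifferentiableOn ℂ φ {z : ℂ | 0 < z.im} ∧ DifferentiableOn ℂ ψ {z : ℂ | 0 < z.im} ∧
    (∃ M : ℝ, ∀ z : ℂ, 0 < z.im → ‖φ z‖ ≤ M) ∧ (∃ M : ℝ, ∀ z : ℂ, 0 < z.im → ‖ψ z‖ ≤ M) ∧
    (∀ z : ℂ, 0 < z.im → ψ z ≠ 0) ∧ ∀ z : ℂ, 0 < z.im → g z = φ z / ψ z

/-- **Boundary value on the real axis** of a function on the upper half-plane: the vertical limit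
`lim_{y → 0⁺} g(x + iy)` (`limUnder`; a junk value at the real `x` where the limit does not exist —
use together with `HasBdryValues`). [cite: ConreyLi2000, §2 (definition of 𝓕(W): boundary values)] -/
def bdryValue (g : ℂ → ℂ) (x : ℝ) : ℂ :=
  limUnder (𝓝[>] (0 : ℝ)) fun y : ℝ ↦ g (x + y * I)

/-- "`g` has boundary values on the real axis": for almost every real `x` the vertical limit
`lim_{y → 0⁺} g(x + iy)` exists (and is then `bdryValue g x`).
[cite: ConreyLi2000, §2 (definition of 𝓕(W): boundary values)] -/
def HasBdryValues (g : ℂ → ℂ) : Prop :=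
  ∀ᵐ x : ℝ, Tendsto (fun y : ℝ ↦ g (x + y * I)) (𝓝[>] (0 : ℝ)) (𝓝 (bdryValue g x))

/-- **The Poisson majorant of `log|g|`** (Conrey–Li's displayed membership inequality):
for `y > 0`, `log|g(x+iy)| ≤ (y/π) ∫ log|g(t)| dt/((t−x)² + y²)`, the integral taken over the
boundary function `bdryValue g` and required to converge; imposed where `g(x+iy) ≠ 0` (at a zero
the printed left-hand side is `−∞` and the inequality is empty).
[cite: ConreyLi2000, §2 (definition of 𝓕(W))] -/
def HasPoissonLogMajorant (g : ℂ → ℂ) : Prop :=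
  ∀ x y : ℝ, 0 < y →
    Integrable (fun t : ℝ ↦ Real.log ‖bdryValue g t‖ / ((t - x) ^ 2 + y ^ 2)) ∧
    (g (x + y * I) ≠ 0 →
      Real.log ‖g (x + y * I)‖ ≤ y / π * ∫ t : ℝ, Real.log ‖bdryValue g t‖ / ((t - x) ^ 2 + y ^ 2))

/-- If the vertical limit of `g` at `x` is `c`, the boundary value is `c` (unfolding of the boundary
values in Conrey–Li's definition). [cite: ConreyLi2000, §2 (definition of 𝓕(W): boundary values)] -/
theorem bdryValue_eq_of_tendsto {g : ℂ → ℂ} {x : ℝ} {c : ℂ}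
    (h : Tendsto (fun y : ℝ ↦ g (x + y * I)) (𝓝[>] (0 : ℝ)) (𝓝 c)) : bdryValue g x = c :=
  h.limUnder_eq

/-- A function continuous at the real point `x` (from within the closed upper half-plane) has
boundary value `g x` there — the case of Conrey–Li §3, where `W = 1/ξ(1 − iz)` "is continuous and
having no zeros in the closed upper half-plane" and boundary values are values.
[cite: ConreyLi2000, §2 (definition of 𝓕(W): boundary values) and §3.1] -/
theorem bdryValue_eq_of_continuousWithinAt {g : ℂ → ℂ} {x : ℝ}
    (h : ContinuousWithinAt g {z : ℂ | 0 ≤ z.im} x) : bdryValue g x = g x := by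
  refine bdryValue_eq_of_tendsto ?_
  have hpath : Tendsto (fun y : ℝ ↦ (x : ℂ) + y * I) (𝓝[>] (0 : ℝ)) (𝓝[{z : ℂ | 0 ≤ z.im}] (x : ℂ)) := by
    refine tendsto_nhdsWithin_iff.2 ⟨?_, ?_⟩
    · have hc : Continuous fun y : ℝ ↦ (x : ℂ) + y * I := by fun_prop
      have h1 : Tendsto (fun y : ℝ ↦ (x : ℂ) + y * I) (𝓝 (0 : ℝ)) (𝓝 (x : ℂ)) := by
        simpa using hc.tendsto 0
      exact h1.mono_left nhdsWithin_le_nhds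
    · filter_upwards [self_mem_nhdsWithin] with y hy
      simp only [add_im, ofReal_im, mul_im, ofReal_re, I_im, I_re, mul_zero, mul_one, zero_add,
        add_zero]
      exact le_of_lt hy
  exact h.tendsto.comp hpath

/-! ## The space `𝓕(W)`: membership, scalar product, kernel, the shift transformation -/

namespace SpaceF

/-- **Membership `F ∈ 𝓕(W)`** (Conrey–Li §2, as printed): `F` is analytic on the open upper
half-plane and `g = F/W` (i) is of bounded type there, (ii) has boundary values on the real axis
which are square integrable (`bdryValue g ∈ L²(ℝ)`), and (iii) satisfies the Poisson majorant
inequality `log|g(x+iy)| ≤ (y/π)∫ log|g(t)| dt/((t−x)²+y²)`, `y > 0`. Only the values of `F`, `W`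
on `{0 < Im z}` enter. Meaningful for `W` analytic and zero-free on the upper half-plane.
[cite: ConreyLi2000, §2 (definition of 𝓕(W))] -/
def Mem (W F : ℂ → ℂ) : Prop :=
  DifferentiableOn ℂ F {z : ℂ | 0 < z.im} ∧
    IsBoundedTypeUHP (fun z ↦ F z / W z) ∧
    HasBdryValues (fun z ↦ F z / W z) ∧
    MemLp (bdryValue fun z ↦ F z / W z) 2 volume ∧
    HasPoissonLogMajorant (fun z ↦ F z / W z)

/-- **The scalar product of `𝓕(W)`**: `⟨F, G⟩_{𝓕(W)} = ∫ F(x) Ḡ(x)/|W(x)|² dx` over the real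
axis, the integrand written through the boundary functions of `F/W` and `G/W`
(`F Ḡ/|W|² = (F/W) · conj(G/W)`); Bochner integral, junk value `0` if not integrable (for members
it is, by Cauchy–Schwarz in `L²`). [cite: ConreyLi2000, §2 (inner product of 𝓕(W))] -/
def inner (W F G : ℂ → ℂ) : ℂ :=
  ∫ x : ℝ, bdryValue (fun z ↦ F z / W z) x * conj (bdryValue (fun z ↦ G z / W z) x)

/-- **The kernel of `𝓕(W)`**: `K(w, z) = W(z) W̄(w) / (2πi (w̄ − z))` (junk value `0` at
`z = conj w`, by `x/0 = 0`; for `w, z` in the upper half-plane `conj w ≠ z`). Its reproducing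
property `F(w) = ⟨F, K(w, ·)⟩_{𝓕(W)}` for `Im w > 0` is Conrey–Li's (2.6), not proved here.
[cite: ConreyLi2000, §2 (2.6)] -/
def kernel (W : ℂ → ℂ) (w z : ℂ) : ℂ :=
  W z * conj (W w) / (2 * π * I * (conj w - z))

/-- **"A linear transformation of `𝓕(W)` into itself which takes `K(w, z)` into `K(w + i, z)` for
all complex `w` with `Im w > 0`"** (the `T` of Conrey–Li's Theorem 2 and of their condition
(3.3)): `T` maps members to members, is additive and homogeneous on members, and sends the kernel
function `K(w, ·)` to `K(w+i, ·)`; all identities are equalities of functions ON THE OPEN UPPER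
HALF-PLANE (where the elements of `𝓕(W)` live). [cite: ConreyLi2000, Theorem 2] -/
structure IsKernelShift (W : ℂ → ℂ) (T : (ℂ → ℂ) → (ℂ → ℂ)) : Prop where
  /-- `T` maps `𝓕(W)` into itself. -/
  mem_map : ∀ F : ℂ → ℂ, Mem W F → Mem W (T F)
  /-- `T` is additive on `𝓕(W)`. -/
  map_add : ∀ F G : ℂ → ℂ, Mem W F → Mem W G →
    Set.EqOn (T (F + G)) (T F + T G) {z : ℂ | 0 < z.im}
  /-- `T` is homogeneous on `𝓕(W)`. -/
  map_smul : ∀ (c : ℂ) (F : ℂ → ℂ), Mem W F → Set.EqOn (T (c • F)) (c • T F) {z : ℂ | 0 < z.im}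
  /-- `T K(w, ·) = K(w + i, ·)` for `Im w > 0`. -/
  map_kernel : ∀ w : ℂ, 0 < w.im → Set.EqOn (T (kernel W w)) (kernel W (w + I)) {z : ℂ | 0 < z.im}

/-- Unfolding the printed scalar product on the diagonal: `⟨F, F⟩_{𝓕(W)} = ∫ |F(x)/W(x)|² dx =
∫ ‖b_{F/W}(x)‖² dx`. [cite: ConreyLi2000, §2 (inner product of 𝓕(W))] -/
theorem inner_self_eq (W F : ℂ → ℂ) :
    inner W F F = ((∫ x : ℝ, ‖bdryValue (fun z ↦ F z / W z) x‖ ^ 2 : ℝ) : ℂ) := by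
  have h : ∀ x : ℝ, bdryValue (fun z ↦ F z / W z) x * conj (bdryValue (fun z ↦ F z / W z) x)
      = ((‖bdryValue (fun z ↦ F z / W z) x‖ ^ 2 : ℝ) : ℂ) := by
    intro x
    rw [Complex.mul_conj', Complex.ofReal_pow]
  unfold inner
  simp_rw [h]
  exact integral_ofReal

/-- `0 ≤ ⟨F, F⟩_{𝓕(W)}` (as a real part) for the printed scalar product.
[cite: ConreyLi2000, §2 (inner product of 𝓕(W))] -/
theorem inner_self_re_nonneg (W F : ℂ → ℂ) : 0 ≤ (inner W F F).re := by
  rw [inner_self_eq, Complex.ofReal_re]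
  exact integral_nonneg fun x ↦ sq_nonneg _

/-- Hermitian symmetry of the printed kernel: `conj K(w, z) = K(z, w)` (valid for every `W`, junk
values included; used in the proof of Theorem 2 to write `2 Re⟨F, TF⟩` as the double sum over
`K(w_α, w_β + i) + K(w_α + i, w_β)`). [cite: ConreyLi2000, §2 (2.6) and proof of Theorem 2] -/
theorem conj_kernel (W : ℂ → ℂ) (w z : ℂ) : conj (kernel W w z) = kernel W z w := by
  unfold kernel
  rw [map_div₀]
  have hden : conj (2 * (π : ℂ) * I * (conj w - z)) = 2 * (π : ℂ) * I * (conj z - w) := by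
    simp only [map_mul, map_sub, Complex.conj_conj, Complex.conj_ofReal, Complex.conj_I, map_ofNat]
    ring
  rw [hden, map_mul, Complex.conj_conj, mul_comm (conj (W z))]

/-- The kernel function `K(w, ·)` divided by `W` is the Cauchy-type kernel
`conj(W w)/(2πi(conj w − z))` wherever `W z ≠ 0` — a rational function of `z` with its pole at
`conj w` in the lower half-plane when `Im w > 0` (so `K(w, ·)/W` is bounded and analytic on the
upper half-plane). [cite: ConreyLi2000, §2 (2.6)] -/
theorem kernel_div (W : ℂ → ℂ) {w z : ℂ} (hz : W z ≠ 0) :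
    kernel W w z / W z = conj (W w) / (2 * π * I * (conj w - z)) := by
  unfold kernel
  field_simp

end SpaceF

/-! ## Conrey–Li 2000, Theorem 2 (named fact) and its proved corollaries -/

/-- **de Branges' positivity theorem for `𝓕(W)`, as stated by Conrey–Li (2000), Theorem 2**
("essentially due to de Branges"). For `W` analytic and zero-free on the open upper half-plane and
`T` a linear transformation of `𝓕(W)` into itself with `T K(w, ·) = K(w+i, ·)` for all `Im w > 0`
(`SpaceF.IsKernelShift W T`): IF `Re ⟨F, TF⟩_{𝓕(W)} ≥ 0` for every `F ∈ 𝓕(W)` (Conrey–Li's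
condition (3.3)), THEN `W` has an analytic extension `W₁` to the half-plane `Im z > −1/2`, and
`W₁(z)/W₁(z + i)` has non-negative real part there (for `Im z > −1/2`, `Im(z+i) > 1/2`, so
`W₁(z+i) = W(z+i) ≠ 0`). Membership `F ∈ 𝓕(W)` and `⟨·,·⟩_{𝓕(W)}` are Conrey–Li's (§2):
`SpaceF.Mem`, `SpaceF.inner`. Not proved here (printed proof: positive-definiteness of
`K(w+i, z) + K(w, z+i)` via (2.6), then a contraction `P` on the space with kernel
`1/(2πi(w̄ − z − i))` and analytic continuation through `P*`, (2.7)–(2.8)). The hypothesis FAILS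
for `W = 1/ξ(1 − iz)` and for every `W_χ = 1/ξ(1 − iz, χ)` (Conrey–Li §3–§4; tree:
`Literature.Barriers.RiemannHypothesis.ConreyLi2000_FW_holds`). [cite: ConreyLi2000, Theorem 2] -/
def conreyLi2000_thm2 : Prop :=
  ∀ W : ℂ → ℂ, DifferentiableOn ℂ W {z : ℂ | 0 < z.im} → (∀ z : ℂ, 0 < z.im → W z ≠ 0) →
    ∀ T : (ℂ → ℂ) → (ℂ → ℂ), SpaceF.IsKernelShift W T →
      (∀ F : ℂ → ℂ, SpaceF.Mem W F → 0 ≤ (SpaceF.inner W F (T F)).re) →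
      ∃ W₁ : ℂ → ℂ, DifferentiableOn ℂ W₁ {z : ℂ | -1 / 2 < z.im} ∧
        Set.EqOn W₁ W {z : ℂ | 0 < z.im} ∧
        ∀ z : ℂ, -1 / 2 < z.im → 0 ≤ (W₁ z / W₁ (z + I)).re

namespace conreyLi2000_thm2

/-- **The necessary condition of Theorem 2 on the open upper half-plane**: under its hypotheses,
`Re{W(z)/W(z+i)} ≥ 0` for `Im z > 0` (there the extension `W₁` is `W` itself). This is the first
line of the printed proof ("This implies that `Re{W(z)/W(z+i)} ≥ 0` for `z` in the upper
half-plane"). [cite: ConreyLi2000, Theorem 2] -/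
theorem re_div_nonneg_of_im_pos (h : conreyLi2000_thm2) {W : ℂ → ℂ}
    (hW : DifferentiableOn ℂ W {z : ℂ | 0 < z.im}) (hW0 : ∀ z : ℂ, 0 < z.im → W z ≠ 0)
    {T : (ℂ → ℂ) → (ℂ → ℂ)} (hT : SpaceF.IsKernelShift W T)
    (hpos : ∀ F : ℂ → ℂ, SpaceF.Mem W F → 0 ≤ (SpaceF.inner W F (T F)).re)
    {z : ℂ} (hz : 0 < z.im) : 0 ≤ (W z / W (z + I)).re := by
  obtain ⟨W₁, -, hEq, hre⟩ := h W hW hW0 T hT hpos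
  have hz' : -1 / 2 < z.im := by linarith
  have h1 : W₁ z = W z := hEq (show z ∈ {z : ℂ | 0 < z.im} from hz)
  have h2 : W₁ (z + I) = W (z + I) :=
    hEq (show z + I ∈ {z : ℂ | 0 < z.im} by simp only [Set.mem_setOf_eq, add_im, I_im]; linarith)
  have := hre z hz'
  rwa [h1, h2] at this

/-- **The necessary condition of Theorem 2 on the closed upper half-plane**: if moreover `W` is
continuous on `{0 ≤ Im z}` (as `1/ξ(1 − iz)` and `1/ξ(1 − iz, χ)` are — "analytic in the upper
half-plane, and is continuous and having no zeros in the closed upper half-plane", Conrey–Li §3),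
then `Re{W(z)/W(z+i)} ≥ 0` for every `z` with `Im z ≥ 0`; in particular at real points
(`Im z = 0 > −1/2`), which is where Conrey–Li evaluate (3.4) (`w = −282`) and its `χ₄` analogue
(`w = −8714.2`). Proof: the extension `W₁` is continuous at a real `x` and agrees with `W` above it,
so `W₁(x) = W(x)` by uniqueness of the vertical limit. [cite: ConreyLi2000, Theorem 2 and §3.1] -/
theorem re_div_nonneg_of_im_nonneg (h : conreyLi2000_thm2) {W : ℂ → ℂ}
    (hW : DifferentiableOn ℂ W {z : ℂ | 0 < z.im}) (hW0 : ∀ z : ℂ, 0 < z.im → W z ≠ 0)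
    (hWc : ContinuousOn W {z : ℂ | 0 ≤ z.im})
    {T : (ℂ → ℂ) → (ℂ → ℂ)} (hT : SpaceF.IsKernelShift W T)
    (hpos : ∀ F : ℂ → ℂ, SpaceF.Mem W F → 0 ≤ (SpaceF.inner W F (T F)).re)
    {z : ℂ} (hz : 0 ≤ z.im) : 0 ≤ (W z / W (z + I)).re := by
  rcases hz.lt_or_eq with hpos_im | hzero
  · exact re_div_nonneg_of_im_pos h hW hW0 hT hpos hpos_im
  obtain ⟨W₁, hW₁, hEq, hre⟩ := h W hW hW0 T hT hpos
  have hz' : -1 / 2 < z.im := by rw [← hzero]; norm_num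
  have h2 : W₁ (z + I) = W (z + I) :=
    hEq (show z + I ∈ {z : ℂ | 0 < z.im} by simp only [Set.mem_setOf_eq, add_im, I_im]; linarith)
  -- `W₁ z = W z`: both are the limit of the common values `W (z + iy)`, `y → 0⁺`
  have hzx : z = ((z.re : ℝ) : ℂ) := by
    apply Complex.ext <;> simp [← hzero]
  have hpath : Tendsto (fun y : ℝ ↦ z + y * I) (𝓝[>] (0 : ℝ)) (𝓝 z) := by
    have hc : Continuous fun y : ℝ ↦ z + y * I := by fun_prop
    have h1 : Tendsto (fun y : ℝ ↦ z + y * I) (𝓝 (0 : ℝ)) (𝓝 z) := by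
      simpa using hc.tendsto 0
    exact h1.mono_left nhdsWithin_le_nhds
  have hmem_open : ∀ᶠ y : ℝ in 𝓝[>] (0 : ℝ), z + y * I ∈ {z : ℂ | 0 < z.im} := by
    filter_upwards [self_mem_nhdsWithin] with y hy
    simp only [add_im, mul_im, ofReal_re, I_im, ofReal_im, I_re, mul_one, mul_zero, add_zero,
      ← hzero, zero_add]
    exact hy
  have hmem_closed : ∀ᶠ y : ℝ in 𝓝[>] (0 : ℝ), z + y * I ∈ {z : ℂ | 0 ≤ z.im} :=
    hmem_open.mono fun y (hy : 0 < (z + y * I).im) ↦ show 0 ≤ (z + y * I).im from le_of_lt hy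
  -- limit of `W₁`
  have hopen : IsOpen {z : ℂ | -1 / 2 < z.im} := isOpen_lt continuous_const Complex.continuous_im
  have hW₁c : ContinuousAt W₁ z := (hW₁.differentiableAt (hopen.mem_nhds hz')).continuousAt
  have hlim₁ : Tendsto (fun y : ℝ ↦ W₁ (z + y * I)) (𝓝[>] (0 : ℝ)) (𝓝 (W₁ z)) :=
    hW₁c.tendsto.comp hpath
  -- limit of `W`
  have hzc : z ∈ {z : ℂ | 0 ≤ z.im} := by simp [← hzero]
  have hlim : Tendsto (fun y : ℝ ↦ W (z + y * I)) (𝓝[>] (0 : ℝ)) (𝓝 (W z)) :=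
    (hWc z hzc).tendsto.comp (tendsto_nhdsWithin_iff.2 ⟨hpath, hmem_closed⟩)
  -- the two functions agree eventually
  have hcongr : (fun y : ℝ ↦ W₁ (z + y * I)) =ᶠ[𝓝[>] (0 : ℝ)] fun y : ℝ ↦ W (z + y * I) :=
    hmem_open.mono fun y hy ↦ hEq hy
  have h1 : W₁ z = W z := tendsto_nhds_unique (hlim₁.congr' hcongr) hlim
  have := hre z hz'
  rwa [h1, h2] at this

/-- **Contrapositive used by Conrey–Li §3**: if `W` is analytic and zero-free on the open upper
half-plane, continuous on the closed one, and `Re{W(z₀)/W(z₀ + i)} < 0` at some `z₀` with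
`Im z₀ ≥ 0`, then NO kernel-shift transformation `T` of `𝓕(W)` satisfies the positivity condition
(3.3). With `W = 1/ξ(1 − iz)`, `z₀ = −282` this is the printed conclusion "the space `𝓕(W)` does not
satisfy the condition (3.3)"; with `W_{χ₄}`, `z₀ = −8714.2`, condition (3.8).
[cite: ConreyLi2000, §3.1 (3.4) and §3.2] -/
theorem not_positivity_of_re_div_neg (h : conreyLi2000_thm2) {W : ℂ → ℂ}
    (hW : DifferentiableOn ℂ W {z : ℂ | 0 < z.im}) (hW0 : ∀ z : ℂ, 0 < z.im → W z ≠ 0)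
    (hWc : ContinuousOn W {z : ℂ | 0 ≤ z.im}) {z₀ : ℂ} (hz₀ : 0 ≤ z₀.im)
    (hneg : (W z₀ / W (z₀ + I)).re < 0) {T : (ℂ → ℂ) → (ℂ → ℂ)} (hT : SpaceF.IsKernelShift W T) :
    ¬ ∀ F : ℂ → ℂ, SpaceF.Mem W F → 0 ≤ (SpaceF.inner W F (T F)).re := fun hpos ↦
  absurd (re_div_nonneg_of_im_nonneg h hW hW0 hWc hT hpos hz₀) (not_le.2 hneg)

end conreyLi2000_thm2

end Literature.Analysis.DeBrangesSpaces

end
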